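import Literature.AnabelianGeometry.EtaleTheta.Discharge.Sec2HasMuLModelChiCusp
import Literature.AnabelianGeometry.EtaleTheta.Discharge.Sec2AutKDottedOfOdd
import Literature.AnabelianGeometry.EtaleTheta.Discharge.Sec2PiCTemperedSide
import HarnessLib

/-!
# [EtTh] Cor. 2.9: the cusp stabiliser of the SECTION cusp datum — `Π^tp(D_x)` and `cuspStabC` of the R312 constructor spelled out,
# and the COLLAPSE of all six `Aut_K`-orbit counts to ONE when `cuspStabC` contains a `Z`-generator (proof-only; node EtTh:Cor2.9)

S. Mochizuki, *The étale theta function and its Frobenioid-theoretic manifestations*, Publ. RIMS **45** (2009) [EtTh], §2: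
p. 35 («`1 → Δ̄_Θ → D̄_x → G_K → 1`»), Cor. 2.9 p. 43 («for each of `Ẋ̲̲, Ċ̲, Ċ̲̲, X̲̲, C̲, C̲̲` … `(ℤ/lℤ)^±` … `Aut_K(−)`-orbits»)
[cite: MochizukiEtTh2009, Cor 2.9 p.43]; [SemiAnbd] Thm. 6.5 (ii) p. 71 («`D_x` is commensurably terminal»). Cell abc-iut, layer L2,
seat abc-iut-L2-d3 (gen 8), node EtTh:Cor2.9, L2-lead row (w2c) «COR29 COUNT AT χ′» (R924): file 1/2 = the generic half; file 2/2
(`Sec2Cor29FalseAtModelChiCuspOfSection`) instantiates it at `χ′`. abc-iut-L2-t12's (w2) files (p484113 `Sec2AutKDottedOfOdd`, p484548,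
p485226) name the piece as NOT delivered («the R312 constructor has no cuspStabC/hC1/hC2 lemmas»). PROOF-ONLY (no definition, no
instance, no `Prop` fact). Inputs BY NAME: abc-iut-L2-t12's `normalizer_tpPiCu_eq` / `normalizer_tpPiCuu_eq` / `normalizer_tpPiXuu_eq` /
`normalizer_inf_PiCdot_eq_of_odd` / `tp_PiXu_le_tp_PiCu` / `index_tp_PiCu` (`Sec2AutKDottedOfOdd`), `index_tp_PiX` (`Sec2Prop24Reduction`),
the R312 constructor `CLevelData.temperedCoverDataOfHuuOfSection` (abc-iut-L2-d3 / L2-t10, `ThetaCoversTemperedOfHuuOfSection`) over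
abc-iut-L2-t10's SECTION cusp datum `PiCData.coverDataAxOfSection` (`Dx := Δ̄_Θ-preimage ⊔ incl(toHat(s(G_K)))`, `ThetaCoversAxOfSection`),
`comap_range_hatInclX` (`Sec2PiCTemperedSide`), `temperedCoverDataOfHuuOfSection_hTheta` / `_tp_PiXu`. Nothing restated.

* §1 (group theory over abc-iut-L2-t2's `TemperedCoverData`): if `cuspStabC = N_{Π^tp_C}(Π^tp(D_x))` contains an element `x` that
  GENERATES `Π^tp_X` over `Π^tp_{X̲}` (`hgen : ∀ g ∈ Π^tp(X), ∃ n, g·xⁿ ∈ Π^tp(X̲)`), then `Π^tp_C = Π^tp_{C̲} · cuspStabC`, so every member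
  `S` with `Π^tp_{C̲} ≤ N(S)` has exactly ONE `Aut_K(S)`-orbit of cusps (`natCard_cuspOrbits_eq_one_of_mem_cuspStabC`); under the printed
  definition `hΘ` of `Δ̄_Θ` and `μ_l ⊆ K` (all normalisers `= Π^tp_{C̲}`) this is ALL SIX members `Ẋ̲̲, Ċ̲, Ċ̲̲, X̲̲, C̲, C̲̲`
  (`natCard_cuspOrbits_six_eq_one_of_mem_cuspStabC`) — versus print's `(l+1)/2` — whence `¬ T.Cor29_card` for `l ≥ 3`
  (`not_cor29_card_of_mem_cuspStabC`); and `hC1` fails as soon as such an `x` lies in `Π^tp(X) ∖ Π^tp(X̲)` (`not_hC1_of_mem_cuspStabC`).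
* §2 (the R312 constructor over ANY `MuTwoSetting`, any section `s`): `Π^tp(X) = inclX(Π^tp_X)` (`…_tp_PiX`), **`Π^tp(D_x) =
  Π^tp(Δ̄_Θ-preimage) · inclX(s(G_K))`** (`comap_sectionDx_eq_sup`, `…_tp_Dx`), hence **`cuspStabC` SPELLED OUT** (`…_cuspStabC`); every
  `z ∈ Π^tp_X` COMMUTING with `s(G_K)` has `inclX(z) ∈ cuspStabC` (it normalises the normal first factor and centralises the second —
  `inclX_mem_normalizer_sectionDatum_of_commute`, `inclX_mem_cuspStabC_ofHuuOfSection_of_commute`); if moreover `toZ(z) = 1` then `hgen`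
  holds (`…_hgen_of_toZ_eq_one`), `inclX(z) ∉ Π^tp(X̲)` (`l ≥ 2`), so: **the six counts are `1`** (`…_natCard_cuspOrbits_six_eq_one`, given
  `HasMuL`), **`¬ Cor29_card`** (`l ≥ 3`), **`¬ hC1`** (`l ≥ 2`).

DIAGNOSIS (for the planners; no new fact): the SECTION datum is normalised, modulo the normal subgroup `Π^tp(Δ̄_Θ-preimage) ⊇
[Δ^tp_X, Δ^tp_X]`, by every `G_K`-FIXED class of `Δ^tp_X/[Δ,Δ]·Δ^l`; a Galois-fixed `Z`-generator (the χ-models' `a`, file 2/2) makes the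
cusp stabiliser swallow `Gal(X̲/X)`. Print's `D_x` is the decomposition group of the cusp, commensurably terminal ([SemiAnbd] Thm. 6.5
(ii)) — what abc-iut-L2-d3's cusp-law cover uses at `κ′` (`Sec2Cor29ModelKrullOfOdd`, count `(l+1)/2` OUTRIGHT). HONEST FRAMING: statements
about OUR typed one-object interface and OUR synthetic cusp datum; nothing of [EtTh]/[SemiAnbd] asserted for genuine tempered fundamental
groups; no side taken on [IUTchIII] Cor. 3.12; typed ≠ proved; instantiated ≠ endorsed.
-/

noncomputable section

namespace Literature.AnabelianGeometry.EtaleTheta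

open Literature.AnabelianGeometry.SemiGraphs ThetaCovers
open _root_.Topology
open scoped Pointwise

/-! ## §1. Group theory over `TemperedCoverData`: a `Z`-generator in the cusp stabiliser collapses the counts -/

namespace ThetaCovers.TemperedCoverData

universe u

variable {l : ℕ} (T : TemperedCoverData.{u} l)

/-- **`hC1` fails** as soon as the cusp stabiliser contains an element of `Π^tp_X ∖ Π^tp_{X̲}`.
[cite: MochizukiEtTh2009, Cor 2.9 p.43] -/
theorem not_hC1_of_mem_cuspStabC {x : T.Gtp} (hx : x ∈ T.cuspStabC) (hxX : x ∈ T.tp T.PiX)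
    (hxu : x ∉ T.tp T.PiXu) : ¬ (T.cuspStabC ⊓ T.tp T.PiX ≤ T.tp T.PiXu) :=
  fun h => hxu (h ⟨hx, hxX⟩)

/-- `Π^tp_{C̲} ⊄ Π^tp_X`: an element of `Π^tp_{C̲}` outside `Π^tp_X` exists (`[Π^tp_C : Π^tp_{C̲}] = l` is odd,
`[Π^tp_C : Π^tp_X] = 2`). [cite: MochizukiEtTh2009, Def 2.1 p.36] -/
theorem exists_mem_tpPiCu_not_mem_tpPiX : ∃ c ∈ T.tp T.PiCu, c ∉ T.tp T.PiX := by
  by_contra h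
  have hle : T.tp T.PiCu ≤ T.tp T.PiX := fun c hc => by_contra fun hcX => h ⟨c, hc, hcX⟩
  have hdvd := Subgroup.index_dvd_of_le hle
  rw [T.index_tp_PiX, T.index_tp_PiCu] at hdvd
  exact (Nat.not_even_iff_odd.mpr T.l_odd) (even_iff_two_dvd.mpr hdvd)

/-- **`Π^tp_C = Π^tp_{C̲} · cuspStabC`** when the cusp stabiliser contains a `Z`-generator `x` of `Π^tp_X` over `Π^tp_{X̲}`.
[cite: MochizukiEtTh2009, Cor 2.9 p.43] -/
theorem exists_mem_tpPiCu_mul_of_mem_cuspStabC {x : T.Gtp} (hx : x ∈ T.cuspStabC)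
    (hgen : ∀ g ∈ T.tp T.PiX, ∃ n : ℤ, g * x ^ n ∈ T.tp T.PiXu) (g : T.Gtp) :
    ∃ h ∈ T.tp T.PiCu, ∃ k ∈ T.cuspStabC, g = h * k := by
  by_cases hg : g ∈ T.tp T.PiX
  · obtain ⟨n, hn⟩ := hgen g hg
    exact ⟨g * x ^ n, T.tp_PiXu_le_tp_PiCu hn, (x ^ n)⁻¹, inv_mem (zpow_mem hx n),
      (mul_inv_cancel_right g (x ^ n)).symm⟩
  · obtain ⟨c, hc, hcX⟩ := T.exists_mem_tpPiCu_not_mem_tpPiX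
    have hcg : c⁻¹ * g ∈ T.tp T.PiX := by
      rw [Subgroup.mul_mem_iff_of_index_two T.index_tp_PiX]
      exact iff_of_false (fun h => hcX (inv_mem_iff.mp h)) hg
    obtain ⟨n, hn⟩ := hgen _ hcg
    refine ⟨c * (c⁻¹ * g * x ^ n), mul_mem hc (T.tp_PiXu_le_tp_PiCu hn), (x ^ n)⁻¹,
      inv_mem (zpow_mem hx n), ?_⟩
    group

/-- **ONE `Aut_K(S)`-orbit of cusps** for every member `S` with `Π^tp_{C̲} ≤ N(Π^tp_S)`, as soon as the cusp stabiliser contains a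
`Z`-generator of `Π^tp_X` over `Π^tp_{X̲}` (the double-coset space `N(S)\Π^tp_C/cuspStabC` is a point). [cite: MochizukiEtTh2009, Cor 2.9 p.43] -/
theorem natCard_cuspOrbits_eq_one_of_mem_cuspStabC {x : T.Gtp} (hx : x ∈ T.cuspStabC)
    (hgen : ∀ g ∈ T.tp T.PiX, ∃ n : ℤ, g * x ^ n ∈ T.tp T.PiXu) {S : Subgroup T.Gtp}
    (hN : T.tp T.PiCu ≤ Subgroup.normalizer (S : Set T.Gtp)) : Nat.card (T.cuspOrbits S) = 1 := by
  have key : ∀ g : T.Gtp, DoubleCoset.mk (Subgroup.normalizer (S : Set T.Gtp)) T.cuspStabC g =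
      DoubleCoset.mk (Subgroup.normalizer (S : Set T.Gtp)) T.cuspStabC 1 := by
    intro g
    obtain ⟨h, hh, k, hk, hg⟩ := T.exists_mem_tpPiCu_mul_of_mem_cuspStabC hx hgen g
    rw [DoubleCoset.eq]
    exact ⟨h⁻¹, inv_mem (hN hh), k⁻¹, inv_mem hk, by rw [hg]; group⟩
  rw [Nat.card_eq_one_iff_unique]
  refine ⟨⟨fun q₁ q₂ => ?_⟩, ⟨DoubleCoset.mk _ _ 1⟩⟩
  induction q₁ using Quotient.inductionOn' with | h a => ?_
  induction q₂ using Quotient.inductionOn' with | h b => ?_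
  change DoubleCoset.mk _ _ a = DoubleCoset.mk _ _ b
  rw [key a, key b]

/-- **All six members `Ẋ̲̲, Ċ̲, Ċ̲̲, X̲̲, C̲, C̲̲` have exactly ONE `Aut_K`-orbit of cusps** (printed definition `hΘ` of `Δ̄_Θ` and
`μ_l ⊆ K`: every normaliser is `Π^tp_{C̲}`) as soon as the cusp stabiliser contains a `Z`-generator of `Π^tp_X` over `Π^tp_{X̲}` —
versus print's `(l+1)/2`. [cite: MochizukiEtTh2009, Cor 2.9 p.43] -/
theorem natCard_cuspOrbits_six_eq_one_of_mem_cuspStabC (hΘ : ⁅T.DeltaX, T.DeltaX⁆ ⊔ T.barKer = T.barTheta)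
    (hmu : T.HasMuL) {x : T.Gtp} (hx : x ∈ T.cuspStabC)
    (hgen : ∀ g ∈ T.tp T.PiX, ∃ n : ℤ, g * x ^ n ∈ T.tp T.PiXu) :
    ∀ S ∈ [T.tp T.PiXuu ⊓ T.PiCdot, T.tp T.PiCu ⊓ T.PiCdot, T.tp T.PiCuu ⊓ T.PiCdot,
      T.tp T.PiXuu, T.tp T.PiCu, T.tp T.PiCuu], Nat.card (T.cuspOrbits S) = 1 := by
  have m1 : T.tp T.PiXuu ∈ [T.tp T.PiXuu, T.tp T.PiXu, T.tp T.PiCuu, T.tp T.PiCu] := by simp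
  have m3 : T.tp T.PiCuu ∈ [T.tp T.PiXuu, T.tp T.PiXu, T.tp T.PiCuu, T.tp T.PiCu] := by simp
  have m4 : T.tp T.PiCu ∈ [T.tp T.PiXuu, T.tp T.PiXu, T.tp T.PiCuu, T.tp T.PiCu] := by simp
  have hXuu : T.tp T.PiCu ≤ Subgroup.normalizer ((T.tp T.PiXuu : Subgroup T.Gtp) : Set T.Gtp) := by
    rw [T.normalizer_tpPiXuu_eq hΘ hmu]
  have hCu : T.tp T.PiCu ≤ Subgroup.normalizer ((T.tp T.PiCu : Subgroup T.Gtp) : Set T.Gtp) := by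
    rw [T.normalizer_tpPiCu_eq]
  have hCuu : T.tp T.PiCu ≤ Subgroup.normalizer ((T.tp T.PiCuu : Subgroup T.Gtp) : Set T.Gtp) := by
    rw [T.normalizer_tpPiCuu_eq hmu]
  intro S hS
  simp only [List.mem_cons, List.not_mem_nil, or_false] at hS
  rcases hS with rfl | rfl | rfl | rfl | rfl | rfl
  · exact T.natCard_cuspOrbits_eq_one_of_mem_cuspStabC hx hgen
      (by rw [T.normalizer_inf_PiCdot_eq_of_odd hΘ hmu m1]; exact hXuu)
  · exact T.natCard_cuspOrbits_eq_one_of_mem_cuspStabC hx hgen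
      (by rw [T.normalizer_inf_PiCdot_eq_of_odd hΘ hmu m4]; exact hCu)
  · exact T.natCard_cuspOrbits_eq_one_of_mem_cuspStabC hx hgen
      (by rw [T.normalizer_inf_PiCdot_eq_of_odd hΘ hmu m3]; exact hCuu)
  · exact T.natCard_cuspOrbits_eq_one_of_mem_cuspStabC hx hgen hXuu
  · exact T.natCard_cuspOrbits_eq_one_of_mem_cuspStabC hx hgen hCu
  · exact T.natCard_cuspOrbits_eq_one_of_mem_cuspStabC hx hgen hCuu

/-- **`¬ T.Cor29_card`** (`l ≥ 3`, `μ_l ⊆ K`) as soon as the cusp stabiliser contains a `Z`-generator of `Π^tp_X` over `Π^tp_{X̲}`: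
the member `C̲` has ONE orbit, print's count is `(l+1)/2 ≥ 2`. [cite: MochizukiEtTh2009, Cor 2.9 p.43] -/
theorem not_cor29_card_of_mem_cuspStabC (hl : 3 ≤ l) (hmu : T.HasMuL) {x : T.Gtp} (hx : x ∈ T.cuspStabC)
    (hgen : ∀ g ∈ T.tp T.PiX, ∃ n : ℤ, g * x ^ n ∈ T.tp T.PiXu) : ¬ T.Cor29_card := by
  intro h
  have h1 := T.natCard_cuspOrbits_eq_one_of_mem_cuspStabC hx hgen (S := T.tp T.PiCu)
    (by rw [T.normalizer_tpPiCu_eq])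
  have h2 := h hmu (T.tp T.PiCu) (by simp)
  rw [h1] at h2
  omega

end ThetaCovers.TemperedCoverData

/-! ## §2. The R312 constructor: `Π^tp(D_x)` and `cuspStabC` of the SECTION cusp datum, spelled out -/

namespace MuTwoSetting.CLevelData

variable {p : ℕ} [Fact p.Prime] {M : MuTwoSetting p}
variable {PC : Type} [Group PC] [TopologicalSpace PC] [IsTopologicalGroup PC] [T2Space PC]

/-- **`ιC⁻¹(D̄_x-preimage) = ιC⁻¹(Δ̄_Θ-preimage) · inclX(s(G_K))`** in `Π^tp_C`: the pull-back of abc-iut-L2-t10's SECTION cusp datum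
`sectionDx = Δ̄_Θ-preimage ⊔ incl(toHat(s(G_K)))` along a completion map `ιC` (the `Δ̄_Θ`-preimage is normal in `Π_C`).
[cite: MochizukiEtTh2009, Def 2.1 p.35] -/
theorem comap_sectionDx_eq_sup (e : M.CLevelData) (ιC : M.GtpC →ₜ* PC) (hιC : IsProfiniteCompletion ιC)
    (op : M.toThetaSetting.OncePuncturedData) (l : ℕ) (s : ↥M.GK →* M.PiTemp) :
    ((e.piCDataOf ιC hιC).sectionDx l s).comap ιC.toMonoidHom =
      ((e.piCDataOf ιC hιC).barTheta l).comap ιC.toMonoidHom ⊔ s.range.map M.inclX := by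
  haveI : ((e.piCDataOf ιC hιC).barTheta l).Normal := (e.piCDataOf ιC hιC).barTheta_normal l op
  change ((e.piCDataOf ιC hιC).barTheta l ⊔ (e.piCDataOf ιC hιC).sectionRange s).comap ιC.toMonoidHom = _
  refine le_antisymm ?_ (sup_le (Subgroup.comap_mono le_sup_left) ?_)
  · intro x hx
    rw [Subgroup.mem_comap] at hx
    have hx' : ιC.toMonoidHom x ∈ (((e.piCDataOf ιC hιC).barTheta l : Set PC) *
        ((e.piCDataOf ιC hιC).sectionRange s : Set PC)) := by
      rw [← Subgroup.normal_mul]; exact hx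
    obtain ⟨t, ht, _, ⟨σ, rfl⟩, htr⟩ := hx'
    have htr' : ιC.toMonoidHom x = t * ιC.toMonoidHom (M.inclX (s σ)) := by
      rw [← htr]
      exact congrArg (t * ·) (e.piCDataOf_incl_toHat ιC hιC (s σ))
    have hmem : x * (M.inclX (s σ))⁻¹ * M.inclX (s σ) ∈
        ((e.piCDataOf ιC hιC).barTheta l).comap ιC.toMonoidHom ⊔ s.range.map M.inclX := by
      refine Subgroup.mul_mem _ (Subgroup.mem_sup_left ?_)
        (Subgroup.mem_sup_right (Subgroup.mem_map.mpr ⟨s σ, ⟨σ, rfl⟩, rfl⟩))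
      rw [Subgroup.mem_comap, map_mul, map_inv, htr', mul_inv_cancel_right]
      exact ht
    rwa [inv_mul_cancel_right] at hmem
  · rintro _ ⟨_, ⟨σ, rfl⟩, rfl⟩
    rw [Subgroup.mem_comap]
    exact Subgroup.mem_sup_right ⟨σ, e.piCDataOf_incl_toHat ιC hιC (s σ)⟩

/-- **Every `z ∈ Π^tp_X` COMMUTING with the section normalises `ιC⁻¹(Δ̄_Θ-preimage) · inclX(s(G_K))`**: `inclX(z)` normalises the
normal first factor and centralises the second. [cite: MochizukiEtTh2009, Cor 2.9 p.43] -/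
theorem inclX_mem_normalizer_sectionDatum_of_commute (e : M.CLevelData) (ιC : M.GtpC →ₜ* PC)
    (hιC : IsProfiniteCompletion ιC) (op : M.toThetaSetting.OncePuncturedData) (l : ℕ) (s : ↥M.GK →* M.PiTemp)
    (z : M.PiTemp) (hz : ∀ σ, Commute z (s σ)) :
    M.inclX z ∈ Subgroup.normalizer
      ((((e.piCDataOf ιC hιC).barTheta l).comap ιC.toMonoidHom ⊔ s.range.map M.inclX : Subgroup M.GtpC) : Set M.GtpC) := by
  haveI : ((e.piCDataOf ιC hιC).barTheta l).Normal := (e.piCDataOf ιC hιC).barTheta_normal l op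
  haveI hBn : (((e.piCDataOf ιC hιC).barTheta l).comap ιC.toMonoidHom).Normal :=
    Subgroup.Normal.comap inferInstance _
  -- one direction, for every element of `Π^tp_X` commuting with the section
  have L : ∀ w : M.PiTemp, (∀ σ, Commute w (s σ)) →
      ∀ n ∈ ((e.piCDataOf ιC hιC).barTheta l).comap ιC.toMonoidHom ⊔ s.range.map M.inclX,
        M.inclX w * n * (M.inclX w)⁻¹ ∈ ((e.piCDataOf ιC hιC).barTheta l).comap ιC.toMonoidHom ⊔ s.range.map M.inclX := by
    intro w hw n hn
    have hfix : ∀ y ∈ s.range.map M.inclX, M.inclX w * y * (M.inclX w)⁻¹ = y := by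
      rintro _ ⟨_, ⟨σ, rfl⟩, rfl⟩
      rw [← map_mul, ← map_inv, ← map_mul, (hw σ).eq, mul_inv_cancel_right]
    have hn' : n ∈ (((((e.piCDataOf ιC hιC).barTheta l).comap ιC.toMonoidHom : Subgroup M.GtpC) : Set M.GtpC) *
        ((s.range.map M.inclX : Subgroup M.GtpC) : Set M.GtpC)) := by
      rw [← Subgroup.normal_mul]; exact hn
    obtain ⟨b, hb, r, hr, rfl⟩ := hn'
    rw [show M.inclX w * (b * r) * (M.inclX w)⁻¹ =
        (M.inclX w * b * (M.inclX w)⁻¹) * (M.inclX w * r * (M.inclX w)⁻¹) by group, hfix r hr]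
    exact Subgroup.mul_mem _ (Subgroup.mem_sup_left (hBn.conj_mem b hb _)) (Subgroup.mem_sup_right hr)
  rw [Subgroup.mem_normalizer_iff]
  intro n
  refine ⟨L z hz n, fun hn => ?_⟩
  have h := L z⁻¹ (fun σ => (hz σ).inv_left) _ hn
  rwa [map_inv, show (M.inclX z)⁻¹ * (M.inclX z * n * (M.inclX z)⁻¹) * (M.inclX z)⁻¹⁻¹ = n by group] at h

section Identities

variable (e : M.CLevelData) (ιC : M.GtpC →ₜ* PC) (hιC : IsProfiniteCompletion ιC)
  (hinj : Function.Injective ιC) (op : M.toThetaSetting.OncePuncturedData) {l : ℕ} (hodd : Odd l)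
  (s : ↥M.GK →* M.PiTemp) (hsa : ∀ σ, M.aug (s σ) = (σ : GQp p)) (hsZ : ∀ σ, M.toZ (s σ) = 1)
  (hιell : ∀ c ∈ (e.piCDataOf ιC hιC).augGK.ker, c ∉ (e.piCDataOf ιC hιC).PiX →
    ∀ d ∈ (e.piCDataOf ιC hιC).PiX ⊓ (e.piCDataOf ιC hιC).augGK.ker,
      c * d * c⁻¹ * d ∈ (e.piCDataOf ιC hιC).barTheta l)
  (hN : ((M.GtpXu l).map M.inclX).Normal) (hY : (M.GtpY.map M.inclX).Normal)
  {E : M.toThetaSetting.EtaleThetaData} (C : E.DoubleUnderline l) (hK : M.barKerTp l ≤ C.Huu)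
  (hsH : ∀ σ, s σ ∈ C.Huu) {g : M.GtpC} (hgX : g ∉ M.inclX.range) (hι : C.IotaStable (e.conjX g))

/-- **`Π^tp` of `X` IS `inclX(Π^tp_X)`** for the R312 constructor (`comap_range_hatInclX` at `Φ := incl`).
[cite: MochizukiEtTh2009, Prop 2.4 p.38] -/
theorem temperedCoverDataOfHuuOfSection_tp_PiX :
    (e.temperedCoverDataOfHuuOfSection ιC hιC hinj op hodd s hsa hsZ hιell hN hY C hK hsH hgX hι).tp
        (e.temperedCoverDataOfHuuOfSection ιC hιC hinj op hodd s hsa hsZ hιell hN hY C hK hsH hgX hι).PiX =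
      M.inclX.range :=
  comap_range_hatInclX ιC hιC (e.piCDataOf ιC hιC).incl (e.piCDataOf_incl_toHat ιC hιC)

/-- **`Π^tp(D_x) = Π^tp(Δ̄_Θ-preimage) · inclX(s(G_K))`** for the R312 constructor (its `D_x` is the SECTION cusp datum
`Δ̄_Θ-preimage ⊔ incl(toHat(s(G_K)))`). [cite: MochizukiEtTh2009, Def 2.1 p.35] -/
theorem temperedCoverDataOfHuuOfSection_tp_Dx :
    (e.temperedCoverDataOfHuuOfSection ιC hιC hinj op hodd s hsa hsZ hιell hN hY C hK hsH hgX hι).tp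
        (e.temperedCoverDataOfHuuOfSection ιC hιC hinj op hodd s hsa hsZ hιell hN hY C hK hsH hgX hι).Dx =
      ((e.piCDataOf ιC hιC).barTheta l).comap ιC.toMonoidHom ⊔ s.range.map M.inclX :=
  e.comap_sectionDx_eq_sup ιC hιC op l s

/-- **`cuspStabC` of the R312 constructor, SPELLED OUT**: `N_{Π^tp_C}(Π^tp(Δ̄_Θ-preimage) · inclX(s(G_K)))` — the lemma row (w2) named
as missing («the R312 constructor has no cuspStabC lemmas»). [cite: MochizukiEtTh2009, Cor 2.9 p.43] -/
theorem temperedCoverDataOfHuuOfSection_cuspStabC :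
    (e.temperedCoverDataOfHuuOfSection ιC hιC hinj op hodd s hsa hsZ hιell hN hY C hK hsH hgX hι).cuspStabC =
      Subgroup.normalizer ((((e.piCDataOf ιC hιC).barTheta l).comap ιC.toMonoidHom ⊔ s.range.map M.inclX :
        Subgroup M.GtpC) : Set M.GtpC) :=
  congrArg (fun H : Subgroup M.GtpC => Subgroup.normalizer (H : Set M.GtpC)) (e.comap_sectionDx_eq_sup ιC hιC op l s)

/-- **Every element of `Π^tp_X` COMMUTING with the section lies in the cusp stabiliser** of the R312 constructor.
[cite: MochizukiEtTh2009, Cor 2.9 p.43] -/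
theorem inclX_mem_cuspStabC_ofHuuOfSection_of_commute (z : M.PiTemp) (hz : ∀ σ, Commute z (s σ)) :
    M.inclX z ∈
      (e.temperedCoverDataOfHuuOfSection ιC hιC hinj op hodd s hsa hsZ hιell hN hY C hK hsH hgX hι).cuspStabC := by
  change M.inclX z ∈ Subgroup.normalizer
    ((((e.piCDataOf ιC hιC).sectionDx l s).comap ιC.toMonoidHom : Subgroup M.GtpC) : Set M.GtpC)
  rw [e.comap_sectionDx_eq_sup ιC hιC op l s]
  exact e.inclX_mem_normalizer_sectionDatum_of_commute ιC hιC op l s z hz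

/-- **`hgen` for the R312 constructor from a degree-one element**: if `toZ z = 1`, every element of `Π^tp(X) = inclX(Π^tp_X)` lies in
`Π^tp(X̲) · inclX(z)^ℤ` (`Π^tp_{X̲} = toZ⁻¹(l·Z)`). [cite: MochizukiEtTh2009, Def 2.5 (i) p.39] -/
theorem temperedCoverDataOfHuuOfSection_hgen_of_toZ_eq_one (z : M.PiTemp) (hz1 : M.toZ z = Multiplicative.ofAdd 1) :
    ∀ x : M.GtpC, x ∈ (e.temperedCoverDataOfHuuOfSection ιC hιC hinj op hodd s hsa hsZ hιell hN hY C hK hsH hgX hι).tp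
        (e.temperedCoverDataOfHuuOfSection ιC hιC hinj op hodd s hsa hsZ hιell hN hY C hK hsH hgX hι).PiX →
      ∃ n : ℤ, x * M.inclX z ^ n ∈
        (e.temperedCoverDataOfHuuOfSection ιC hιC hinj op hodd s hsa hsZ hιell hN hY C hK hsH hgX hι).tp
          (e.temperedCoverDataOfHuuOfSection ιC hιC hinj op hodd s hsa hsZ hιell hN hY C hK hsH hgX hι).PiXu := by
  intro x hx
  rw [temperedCoverDataOfHuuOfSection_tp_PiX] at hx
  obtain ⟨w, rfl⟩ := hx
  refine ⟨-(Multiplicative.toAdd (M.toZ w)), ?_⟩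
  rw [temperedCoverDataOfHuuOfSection_tp_PiXu]
  change M.inclX w * M.inclX z ^ (-(Multiplicative.toAdd (M.toZ w))) ∈ (M.GtpXu l).map M.inclX
  rw [← map_zpow, ← map_mul]
  refine Subgroup.mem_map_of_mem _ ?_
  change M.toZ (w * z ^ (-(Multiplicative.toAdd (M.toZ w)))) ∈ ThetaSetting.lZ l
  have h1 : M.toZ (w * z ^ (-(Multiplicative.toAdd (M.toZ w)))) = 1 := by
    rw [map_mul, map_zpow, hz1, ← Int.ofAdd_mul, one_mul]
    generalize M.toZ w = m
    rw [ofAdd_neg, ofAdd_toAdd, mul_inv_cancel]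
  rw [h1]
  exact one_mem _

/-- **A degree-one element is outside `Π^tp(X̲)`** (`l ≥ 2`). [cite: MochizukiEtTh2009, Def 2.5 (i) p.39] -/
theorem inclX_not_mem_tp_PiXu_ofHuuOfSection_of_toZ_eq_one (hl2 : 2 ≤ l) (z : M.PiTemp)
    (hz1 : M.toZ z = Multiplicative.ofAdd 1) :
    M.inclX z ∉ (e.temperedCoverDataOfHuuOfSection ιC hιC hinj op hodd s hsa hsZ hιell hN hY C hK hsH hgX hι).tp
        (e.temperedCoverDataOfHuuOfSection ιC hιC hinj op hodd s hsa hsZ hιell hN hY C hK hsH hgX hι).PiXu := by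
  rw [temperedCoverDataOfHuuOfSection_tp_PiXu]
  change M.inclX z ∉ (M.GtpXu l).map M.inclX
  rw [Subgroup.mem_map_iff_mem M.injective_inclX]
  change ¬ M.toZ z ∈ ThetaSetting.lZ l
  rw [hz1, Subgroup.mem_zpowers_iff]
  rintro ⟨k, hk⟩
  rw [← Int.ofAdd_mul] at hk
  have hk' : (l : ℤ) * k = 1 := Multiplicative.ofAdd.injective hk
  have hl1 : (l : ℤ) = 1 := Int.eq_one_of_mul_eq_one_right (by omega) hk'
  omega

/-- **THE COLLAPSE for the R312 constructor**: a degree-one element of `Π^tp_X` commuting with the section puts `inclX(z)` in the cusp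
stabiliser, whence (with the constructor's own `hΘ`, and `μ_l ⊆ K`) each of the six members `Ẋ̲̲, Ċ̲, Ċ̲̲, X̲̲, C̲, C̲̲` has exactly ONE
`Aut_K`-orbit of cusps. [cite: MochizukiEtTh2009, Cor 2.9 p.43] -/
theorem temperedCoverDataOfHuuOfSection_natCard_cuspOrbits_six_eq_one (z : M.PiTemp) (hz : ∀ σ, Commute z (s σ))
    (hz1 : M.toZ z = Multiplicative.ofAdd 1)
    (hmu : (e.temperedCoverDataOfHuuOfSection ιC hιC hinj op hodd s hsa hsZ hιell hN hY C hK hsH hgX hι).HasMuL) :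
    let T := e.temperedCoverDataOfHuuOfSection ιC hιC hinj op hodd s hsa hsZ hιell hN hY C hK hsH hgX hι
    ∀ S ∈ [T.tp T.PiXuu ⊓ T.PiCdot, T.tp T.PiCu ⊓ T.PiCdot, T.tp T.PiCuu ⊓ T.PiCdot, T.tp T.PiXuu, T.tp T.PiCu,
      T.tp T.PiCuu], Nat.card (T.cuspOrbits S) = 1 :=
  (e.temperedCoverDataOfHuuOfSection ιC hιC hinj op hodd s hsa hsZ hιell hN hY C hK hsH hgX hι)
      |>.natCard_cuspOrbits_six_eq_one_of_mem_cuspStabC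
    (e.temperedCoverDataOfHuuOfSection_hTheta ιC hιC hinj op hodd s hsa hsZ hιell hN hY C hK hsH hgX hι) hmu
    (e.inclX_mem_cuspStabC_ofHuuOfSection_of_commute ιC hιC hinj op hodd s hsa hsZ hιell hN hY C hK hsH hgX hι z hz)
    (e.temperedCoverDataOfHuuOfSection_hgen_of_toZ_eq_one ιC hιC hinj op hodd s hsa hsZ hιell hN hY C hK hsH hgX hι z hz1)

/-- **`¬ Cor29_card` for the R312 constructor** from a degree-one element commuting with the section (`l ≥ 3`, `μ_l ⊆ K`).
[cite: MochizukiEtTh2009, Cor 2.9 p.43] -/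
theorem temperedCoverDataOfHuuOfSection_not_cor29_card (hl3 : 3 ≤ l) (z : M.PiTemp) (hz : ∀ σ, Commute z (s σ))
    (hz1 : M.toZ z = Multiplicative.ofAdd 1)
    (hmu : (e.temperedCoverDataOfHuuOfSection ιC hιC hinj op hodd s hsa hsZ hιell hN hY C hK hsH hgX hι).HasMuL) :
    ¬ (e.temperedCoverDataOfHuuOfSection ιC hιC hinj op hodd s hsa hsZ hιell hN hY C hK hsH hgX hι).Cor29_card :=
  (e.temperedCoverDataOfHuuOfSection ιC hιC hinj op hodd s hsa hsZ hιell hN hY C hK hsH hgX hι)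
      |>.not_cor29_card_of_mem_cuspStabC hl3 hmu
    (e.inclX_mem_cuspStabC_ofHuuOfSection_of_commute ιC hιC hinj op hodd s hsa hsZ hιell hN hY C hK hsH hgX hι z hz)
    (e.temperedCoverDataOfHuuOfSection_hgen_of_toZ_eq_one ιC hιC hinj op hodd s hsa hsZ hιell hN hY C hK hsH hgX hι z hz1)

/-- **`¬ hC1` for the R312 constructor** from a degree-one element commuting with the section (`l ≥ 2`).
[cite: MochizukiEtTh2009, Cor 2.9 p.43] -/
theorem temperedCoverDataOfHuuOfSection_not_hC1 (hl2 : 2 ≤ l) (z : M.PiTemp) (hz : ∀ σ, Commute z (s σ))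
    (hz1 : M.toZ z = Multiplicative.ofAdd 1) :
    let T := e.temperedCoverDataOfHuuOfSection ιC hιC hinj op hodd s hsa hsZ hιell hN hY C hK hsH hgX hι
    ¬ (T.cuspStabC ⊓ T.tp T.PiX ≤ T.tp T.PiXu) :=
  (e.temperedCoverDataOfHuuOfSection ιC hιC hinj op hodd s hsa hsZ hιell hN hY C hK hsH hgX hι).not_hC1_of_mem_cuspStabC
    (e.inclX_mem_cuspStabC_ofHuuOfSection_of_commute ιC hιC hinj op hodd s hsa hsZ hιell hN hY C hK hsH hgX hι z hz)
    (by rw [temperedCoverDataOfHuuOfSection_tp_PiX]; exact ⟨z, rfl⟩)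
    (e.inclX_not_mem_tp_PiXu_ofHuuOfSection_of_toZ_eq_one ιC hιC hinj op hodd s hsa hsZ hιell hN hY C hK hsH hgX hι hl2
      z hz1)

end Identities

end MuTwoSetting.CLevelData

end Literature.AnabelianGeometry.EtaleTheta

end
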